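import Summits.HodgeConjecture.CorCM.GaloisCyclicSemidirectEightDifferencePairs
import HarnessLib

/-!
# Difference-pair certificates: `C₇ ⋊ C₈`, `C₂₃ ⋊ C₈`, `C₃₁ ⋊ C₈` and `C₇₁ ⋊ C₈` are BAD

COR-CM (cell `pub-hodgecm2`), binder seat b04 (gen 28), count-neutral claim CYCLIC-SEMIDIRECT-EIGHT-DEGENERATE, part IV — instances
of part III (`exists_simple_degenerate_of_differencePair`): a Galois CM field `K` with `Gal(K/ℚ) ≅ C_p ⋊ C₈` (`φ(1)` = inversion)
carries a simple DEGENERATE CM abelian `4p`-fold with a rational `(q,q)` class outside the divisor ring on some power, as soon as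
`ℤ/p` has a DIFFERENCE PAIR `(S, S′)`: `#{(a,b) ∈ S′²: a − b = d} + 2|S| = |S′| + 2·#{(a,b) ∈ S²: a − b = d}` for all `d`,
`S ∉ {∅, ℤ/p}`.  The whole certificate is a pair of subsets of `ℤ/p`, checked by `decide` on `ℤ/p` alone (no balanced set on the
group of order `8p`, no LLL):

* **`C₇ ⋊ C₈`** (`exists_simple_degenerate_cyclic7_semidirect8`): `S = {0}`, `S′ = {0, 1, 3}` — the FANO PLANE (a planar difference
  set has `#{a − b = d} = 1 = |S′| − 2` for `d ≠ 0`); this is the structure behind gen 26's SAT certificate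
  `CorCM/GaloisFiftySixC7SemidirectC8Degenerate`.
* **`C₂₃ ⋊ C₈`** (`exists_simple_degenerate_cyclic23_semidirect8`): `S = {0, 1, 3}`, `S′ = {0, 1, 2, 3, 4, 7, 10, 12}` (difference
  function of `S′` = `2 + 2·𝟙_{±{1,2,3}}`); cf. the SAT certificate `CorCM/GaloisOneEightyFourC23SemidirectC8Degenerate` (gen 27).
* **`C₃₁ ⋊ C₈`** (`exists_simple_degenerate_cyclic31_semidirect8`): `S = {0, 1, 6}`, `S′ = (S + S) ∪ {15} = {0, 1, 2, 6, 7, 12, 15}`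
  — NEW: `p = 31 ≡ 7 (mod 8)` was open (the SAT encodings of gen 27 stop being practical near order `250`).
* **`C₇₁ ⋊ C₈`** (`exists_simple_degenerate_cyclic71_semidirect8`): `S = {0, 1, 6, 14, 31}`,
  `S′ = {0, 1, 4, 6, 14, 41, 46, 47, 54, 55, 60}` (`|S′| = 2|S| + 1`, difference function of `S′` = `1 + 2·𝟙_{S−S}`) — NEW,
  order `568`: the only class of `5`-sets among the `2629` affine classes of `ℤ/71` that extends (compute job j212096, 3.4 h on
  28 cores); `p = 47` has NO difference pair at all (j212095: the `715` classes of `5`-sets exhausted, `(5, 12)` being the only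
  admissible size) — its BAD type must be `μ₄`-valued.

Sizes follow `(|S|, |S′|) = (B(A − 2B), (p − |A² − 4AB + 2B²|)/2)` for `p = A² − 2B²`: `7 = 3² − 2`, `23 = 5² − 2`, `31 = 7² − 2·3²`,
`71 = 11² − 2·5²`.
The pairs were found by exhaustive search over affine classes of `S` (seat folder `scratch/pairsearch.py`; compute jobs j212095
(`p = 47`: none) and j212096 (`p = 71`)).  KERNEL ONLY: theorems; no definition, no named fact, no `sorry`.  `HC_CM` is neither
used nor claimed.

## References

* [Shimura1998] G. Shimura, *Abelian Varieties with Complex Multiplication and Modular Functions*, §6.2 Thm. 3, §8.2 Prop. 26.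
* [Gordon1999HodgeAVSurvey] B. B. Gordon, *A survey of the Hodge conjecture for abelian varieties*, Thm. 6.4, §9.3.
* [Kubota1965] T. Kubota, *On the field extension by complex multiplication*, Trans. AMS 118 (1965), §4 Lemma 2.
-/

noncomputable section

open CategoryTheory CategoryTheory.Limits NumberField
open scoped BigOperators

namespace Summit.HodgeConjecture.CorCM.GaloisCyclicSemidirectEight

open Literature.NumberTheory.ComplexMultiplication
open Literature.AlgebraicGeometry.Motives (AbelianVariety CMType)
open Literature.AlgebraicGeometry.HodgeTheory
open Literature.AlgebraicGeometry.ComplexMultiplication (IsCMTypeRealisation)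
open Literature.AlgebraicGeometry.Pohlmann1968
open Literature.Barriers.HodgeConjecture (divisorClassesSpan)

variable {K : Type} [Field K] [NumberField K] [IsCMField K] [IsGalois ℚ K]

/-- **`Gal(K/ℚ) ≅ C₇ ⋊ C₈` is BAD, by the Fano plane**: the difference pair `S = {0}`, `S′ = {0,1,3}` in `ℤ/7` gives a simple
DEGENERATE abelian `28`-fold with CM by `K` and a rational `(q,q)` class outside the divisor ring on some power.
[cite: Shimura1998, §6.2 Thm. 3 and §8.2 Prop. 26] [cite: Gordon1999HodgeAVSurvey, Thm. 6.4 and §9.3] -/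
theorem exists_simple_degenerate_cyclic7_semidirect8
    (φ : Multiplicative (ZMod 8) →* MulAut (Multiplicative (ZMod 7)))
    (hφ : ∀ v : Multiplicative (ZMod 7), φ (Multiplicative.ofAdd 1) v = v⁻¹)
    (e : (K ≃ₐ[ℚ] K) ≃* Multiplicative (ZMod 7) ⋊[φ] Multiplicative (ZMod 8)) :
    ∃ (Φ : CMType K) (φ₀ : K →+* ℂ) (A : AbelianVariety ℂ) (ι : 𝓞 K →+* End A)
      (θ : K →+* Module.End ℂ (complexBetti A.X 1)),
      IsPrimitive (ℂ ≃+* ℂ) Φ.1 φ₀ ∧ ¬ IsNondegenerate Φ ∧ IsCMTypeRealisation Φ A ι θ ∧ A.IsSimple ∧ A.dim = 28 ∧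
      ∃ n q : ℕ, ∃ x : complexBetti (⨁ fun _ : Fin n => A).X (2 * q), IsRationalClass x ∧
        IsOfHodgeType (⨁ fun _ : Fin n => A).dim (⨁ fun _ : Fin n => A).X (2 * q) q q x ∧
        x ∉ divisorClassesSpan (⨁ fun _ : Fin n => A).X (⨁ fun _ : Fin n => A).dim q := by
  obtain ⟨Φ, φ₀, A, ι, θ, h1, h2, h3, h4, h5, h6⟩ := @exists_simple_degenerate_of_differencePair 7 ⟨by norm_num⟩ K _ _ _ _
    (by norm_num) φ hφ e {0} {0, 1, 3} ⟨0, by decide⟩ ⟨1, by decide⟩ (by decide)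
  exact ⟨Φ, φ₀, A, ι, θ, h1, h2, h3, h4, by norm_num at h5; exact h5, h6⟩

/-- **`Gal(K/ℚ) ≅ C₂₃ ⋊ C₈` is BAD**: the difference pair `S = {0,1,3}`, `S′ = {0,1,2,3,4,7,10,12}` in `ℤ/23` gives a simple
DEGENERATE abelian `92`-fold with CM by `K` and a rational `(q,q)` class outside the divisor ring on some power.
[cite: Shimura1998, §6.2 Thm. 3 and §8.2 Prop. 26] [cite: Gordon1999HodgeAVSurvey, Thm. 6.4 and §9.3] -/
theorem exists_simple_degenerate_cyclic23_semidirect8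
    (φ : Multiplicative (ZMod 8) →* MulAut (Multiplicative (ZMod 23)))
    (hφ : ∀ v : Multiplicative (ZMod 23), φ (Multiplicative.ofAdd 1) v = v⁻¹)
    (e : (K ≃ₐ[ℚ] K) ≃* Multiplicative (ZMod 23) ⋊[φ] Multiplicative (ZMod 8)) :
    ∃ (Φ : CMType K) (φ₀ : K →+* ℂ) (A : AbelianVariety ℂ) (ι : 𝓞 K →+* End A)
      (θ : K →+* Module.End ℂ (complexBetti A.X 1)),
      IsPrimitive (ℂ ≃+* ℂ) Φ.1 φ₀ ∧ ¬ IsNondegenerate Φ ∧ IsCMTypeRealisation Φ A ι θ ∧ A.IsSimple ∧ A.dim = 92 ∧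
      ∃ n q : ℕ, ∃ x : complexBetti (⨁ fun _ : Fin n => A).X (2 * q), IsRationalClass x ∧
        IsOfHodgeType (⨁ fun _ : Fin n => A).dim (⨁ fun _ : Fin n => A).X (2 * q) q q x ∧
        x ∉ divisorClassesSpan (⨁ fun _ : Fin n => A).X (⨁ fun _ : Fin n => A).dim q := by
  obtain ⟨Φ, φ₀, A, ι, θ, h1, h2, h3, h4, h5, h6⟩ := @exists_simple_degenerate_of_differencePair 23 ⟨by norm_num⟩ K _ _ _ _
    (by norm_num) φ hφ e {0, 1, 3} {0, 1, 2, 3, 4, 7, 10, 12} ⟨0, by decide⟩ ⟨2, by decide⟩ (by decide)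
  exact ⟨Φ, φ₀, A, ι, θ, h1, h2, h3, h4, by norm_num at h5; exact h5, h6⟩

/-- **`Gal(K/ℚ) ≅ C₃₁ ⋊ C₈` is BAD**: the difference pair `S = {0,1,6}`, `S′ = {0,1,2,6,7,12,15}` in `ℤ/31` gives a simple
DEGENERATE abelian `124`-fold with CM by `K` and a rational `(q,q)` class outside the divisor ring on some power.
[cite: Shimura1998, §6.2 Thm. 3 and §8.2 Prop. 26] [cite: Gordon1999HodgeAVSurvey, Thm. 6.4 and §9.3] -/
theorem exists_simple_degenerate_cyclic31_semidirect8
    (φ : Multiplicative (ZMod 8) →* MulAut (Multiplicative (ZMod 31)))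
    (hφ : ∀ v : Multiplicative (ZMod 31), φ (Multiplicative.ofAdd 1) v = v⁻¹)
    (e : (K ≃ₐ[ℚ] K) ≃* Multiplicative (ZMod 31) ⋊[φ] Multiplicative (ZMod 8)) :
    ∃ (Φ : CMType K) (φ₀ : K →+* ℂ) (A : AbelianVariety ℂ) (ι : 𝓞 K →+* End A)
      (θ : K →+* Module.End ℂ (complexBetti A.X 1)),
      IsPrimitive (ℂ ≃+* ℂ) Φ.1 φ₀ ∧ ¬ IsNondegenerate Φ ∧ IsCMTypeRealisation Φ A ι θ ∧ A.IsSimple ∧ A.dim = 124 ∧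
      ∃ n q : ℕ, ∃ x : complexBetti (⨁ fun _ : Fin n => A).X (2 * q), IsRationalClass x ∧
        IsOfHodgeType (⨁ fun _ : Fin n => A).dim (⨁ fun _ : Fin n => A).X (2 * q) q q x ∧
        x ∉ divisorClassesSpan (⨁ fun _ : Fin n => A).X (⨁ fun _ : Fin n => A).dim q := by
  obtain ⟨Φ, φ₀, A, ι, θ, h1, h2, h3, h4, h5, h6⟩ := @exists_simple_degenerate_of_differencePair 31 ⟨by norm_num⟩ K _ _ _ _
    (by norm_num) φ hφ e {0, 1, 6} {0, 1, 2, 6, 7, 12, 15} ⟨0, by decide⟩ ⟨2, by decide⟩ (by decide)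
  exact ⟨Φ, φ₀, A, ι, θ, h1, h2, h3, h4, by norm_num at h5; exact h5, h6⟩

/-- **`Gal(K/ℚ) ≅ C₇₁ ⋊ C₈` is BAD**: the difference pair `S = {0,1,6,14,31}`, `S′ = {0,1,4,6,14,41,46,47,54,55,60}` in `ℤ/71`
gives a simple DEGENERATE abelian `284`-fold with CM by `K` and a rational `(q,q)` class outside the divisor ring on some power.
[cite: Shimura1998, §6.2 Thm. 3 and §8.2 Prop. 26] [cite: Gordon1999HodgeAVSurvey, Thm. 6.4 and §9.3] -/
theorem exists_simple_degenerate_cyclic71_semidirect8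
    (φ : Multiplicative (ZMod 8) →* MulAut (Multiplicative (ZMod 71)))
    (hφ : ∀ v : Multiplicative (ZMod 71), φ (Multiplicative.ofAdd 1) v = v⁻¹)
    (e : (K ≃ₐ[ℚ] K) ≃* Multiplicative (ZMod 71) ⋊[φ] Multiplicative (ZMod 8)) :
    ∃ (Φ : CMType K) (φ₀ : K →+* ℂ) (A : AbelianVariety ℂ) (ι : 𝓞 K →+* End A)
      (θ : K →+* Module.End ℂ (complexBetti A.X 1)),
      IsPrimitive (ℂ ≃+* ℂ) Φ.1 φ₀ ∧ ¬ IsNondegenerate Φ ∧ IsCMTypeRealisation Φ A ι θ ∧ A.IsSimple ∧ A.dim = 284 ∧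
      ∃ n q : ℕ, ∃ x : complexBetti (⨁ fun _ : Fin n => A).X (2 * q), IsRationalClass x ∧
        IsOfHodgeType (⨁ fun _ : Fin n => A).dim (⨁ fun _ : Fin n => A).X (2 * q) q q x ∧
        x ∉ divisorClassesSpan (⨁ fun _ : Fin n => A).X (⨁ fun _ : Fin n => A).dim q := by
  obtain ⟨Φ, φ₀, A, ι, θ, h1, h2, h3, h4, h5, h6⟩ := @exists_simple_degenerate_of_differencePair 71 ⟨by norm_num⟩ K _ _ _ _
    (by norm_num) φ hφ e {0, 1, 6, 14, 31} {0, 1, 4, 6, 14, 41, 46, 47, 54, 55, 60} ⟨0, by decide⟩ ⟨2, by decide⟩ (by decide)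
  exact ⟨Φ, φ₀, A, ι, θ, h1, h2, h3, h4, by norm_num at h5; exact h5, h6⟩

end Summit.HodgeConjecture.CorCM.GaloisCyclicSemidirectEight

end
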